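import Summits.ResolutionOfSingularities.ResolutionOfSingularities.Theorems.PurelyInseparableDim4BlowupHasseTransfer
import Summits.ResolutionOfSingularities.ResolutionOfSingularities.Theorems.PurelyInseparableDim4IsolatedConeOneFree
import Summits.ResolutionOfSingularities.ResolutionOfSingularities.Theorems.PurelyInseparableDim4IsolatedCleaning
import Summits.ResolutionOfSingularities.ResolutionOfSingularities.Theorems.PurelyInseparableDim4IsolationConverse
import Mathlib.Algebra.Polynomial.Div
import HarnessLib
import HarnessLib.Audit.Tags

/-!
# Purely inseparable dim 4 — the free-tail lemma FT(p, p), proved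

**`FreeTailProof.noIsolatedFreeTailAt_self : FreeTail.NoIsolatedFreeTailAt p p`** for every prime `p`
and every field of characteristic `p` (CARD I-7-2 (FT), p-9's `PurelyInseparableDim4FreeTail`): a
witnessed `Step0 p` chain whose steps are all FREE from index `k₀` on passes through a non-isolated
state (indeed `c k₀` is not isolated).  ELEMENTARY ROUTE — finite POLYNOMIAL arcs and the isolation
certificate; no formal arcs, no completion, no straightening automorphism:

1. `aeval_blowup_eq` — the blow-up substitution `σ_{j,b}` (`y_i ↦ y_j(y_i + b_i)`, `y_j ↦ y_j`) turns a
   state of order `≥ p` into `y_j^p · T`, `T` the frame's `pointTransform`; `hasseDeriv_X_pow_mul` —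
   `D^{(β)}(y_j^p T) = y_j^p D^{(β)} T` for `|β| < p` (`C(p, k) ≡ 0`); cleaning is invisible to
   `D^{(β)}`, `0 < |β| < p` (`IsolatedBand.hasseDeriv_deletePthPowers`).
2. `arc_step` — with the transfer identity `φ(D^{(γ)}F)·y_j^{|γ|} ∈ ⟨D^{(β)}(φF) : 0 < |β| ≤ |γ|⟩`
   (`BlowupHasse.map_hasseDeriv_mul_X_pow_mem_span`): along a polynomial arc `Λ` at the successor's
   level with `Λ_j(0) = 0 ≠ Λ_j`, `t^m ∣ D^{(β)}F⁺(Λ)` for all `β` forces `t^{m+1} ∣ D^{(γ)}F(σ∘Λ)`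
   for all `γ` (gain `p − |γ| ≥ 1`).
3. `arc_segment` — along a FREE segment `ℓ … ℓ+n` the arcs `t·𝟙 ↦ σ_{ℓ+n}∘… ↦ σ_ℓ∘⋯` keep a non-zero
   linear term in the chart coordinate precisely because each step is free (`¬ IsSatellite` ⟺ the
   next direction has a non-zero component along the last exceptional coordinate, `arc_coeff`); at
   the bottom `t^{n+1} ∣ D^{(γ)}F_ℓ(Λ)`, `Λ(0) = 0`, `Λ_{j ℓ} = a·t + O(t²)`, `a ≠ 0`.
4. `noIsolatedFreeTailAt_self` — an isolation certificate `𝔪₀^N ≤ J_p⁺ + 𝔪₀^{N+1}`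
   (`IsolationConverse.exists_certificate_of_isIsolated`, p-14) with `n = N` gives
   `x_{j k₀}^N = g + r ↦ t^N u^N ∈ (t^{N+1})`, `u(0) = a ≠ 0`: contradiction.

Consequences (sequel `PurelyInseparableDim4FreeTailConsequences`): K2(3) = `NoIsolatedBandRun3`
unconditionally, no isolated cone chain with `ē ≡ 1`, and `NoIsolatedTrap 3 3 ⟺ E2(3,3)`.
OURS; nothing here proves `NoIsolatedTrap 3 3` or resolution in dimension `≥ 4` / characteristic `p`.
Supports stmt-ResolutionOfSingularities-16155 (helper).
-/

set_option linter.dupNamespace false -- mandated namespace of this single-conjunct summit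

namespace Summit.ResolutionOfSingularities.ResolutionOfSingularities.Theorems.PIDim4

namespace FreeTailProof

open MvPolynomial Finset
open Literature.AlgebraicGeometry
open Literature.AlgebraicGeometry.Resolution

variable {K : Type} [Field K]

/-! ## 1. The blow-up substitution and the point transform: `φ F = y_j^p · T` -/

/-- On a monomial of degree `≥ q`: `σ_{j,b}^*(c·x^d) = y_j^q · translate_b (c·y^{d'})`, `d' = d` with
`d'_j = |d| − q` (the chart exponent of the point blow-up). [folklore] -/
theorem aeval_blowup_monomial (q : ℕ) (j : Fin 4) (b : Fin 4 → K) (hbj : b j = 0)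
    (d : Fin 4 →₀ ℕ) (hd : q ≤ d.degree) (c : K) :
    aeval (fun i => if i = j then (X j : MvPolynomial (Fin 4) K) else X j * (X i + C (b i)))
        (monomial d c) =
      X j ^ q * PointBlowup.translate b (monomial (d.update j (d.degree - q)) c) := by
  classical
  rw [PointBlowup.translate, aeval_monomial, aeval_monomial, algebraMap_eq,
    Finsupp.prod_fintype _ _ (fun i => pow_zero _), Finsupp.prod_fintype _ _ (fun i => pow_zero _),
    ← Finset.mul_prod_erase Finset.univ _ (Finset.mem_univ j),
    ← Finset.mul_prod_erase Finset.univ (fun i => (X i + C (b i)) ^ (d.update j (d.degree - q)) i)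
      (Finset.mem_univ j)]
  simp only [if_true, Finsupp.coe_update, Function.update_self, hbj, C_0, add_zero]
  have h1 : ∏ i ∈ Finset.univ.erase j,
      (if i = j then (X j : MvPolynomial (Fin 4) K) else X j * (X i + C (b i))) ^ d i =
      X j ^ (∑ i ∈ Finset.univ.erase j, d i) * ∏ i ∈ Finset.univ.erase j, (X i + C (b i)) ^ d i := by
    rw [← Finset.prod_pow_eq_pow_sum, ← Finset.prod_mul_distrib]
    refine Finset.prod_congr rfl fun i hi => ?_
    rw [if_neg (Finset.ne_of_mem_erase hi), mul_pow]
  have h2 : ∏ i ∈ Finset.univ.erase j, (X i + C (b i)) ^ Function.update (⇑d) j (d.degree - q) i =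
      ∏ i ∈ Finset.univ.erase j, ((X i : MvPolynomial (Fin 4) K) + C (b i)) ^ d i :=
    Finset.prod_congr rfl fun i hi => by rw [Function.update_of_ne (Finset.ne_of_mem_erase hi)]
  have hdeg : d.degree = d j + ∑ i ∈ Finset.univ.erase j, d i := by
    rw [BlowupHasse.degree_eq_sum_univ, ← Finset.add_sum_erase _ _ (Finset.mem_univ j)]
  rw [h1, h2]
  have hpow : (X j : MvPolynomial (Fin 4) K) ^ d j * X j ^ (∑ i ∈ Finset.univ.erase j, d i) =
      X j ^ q * X j ^ (d.degree - q) := by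
    rw [← pow_add, ← pow_add, ← hdeg, Nat.add_sub_cancel' hd]
  calc C c * ((X j : MvPolynomial (Fin 4) K) ^ d j *
        (X j ^ (∑ i ∈ Finset.univ.erase j, d i) * ∏ i ∈ Finset.univ.erase j, (X i + C (b i)) ^ d i))
      = C c * (X j ^ d j * X j ^ (∑ i ∈ Finset.univ.erase j, d i)) *
          ∏ i ∈ Finset.univ.erase j, (X i + C (b i)) ^ d i := by ring
    _ = X j ^ q * (C c * (X j ^ (d.degree - q) *
          ∏ i ∈ Finset.univ.erase j, (X i + C (b i)) ^ d i)) := by rw [hpow]; ring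

/-- **`σ_{j,b}^* F = y_j^q · T`** for the point transform `T = translate_b (chartTransform_j F)` of the
frame (`CentreBlowup.pointTransform`), when `ord₀ F ≥ q` and `b_j = 0`. [folklore] -/
theorem aeval_blowup_eq (q : ℕ) (j : Fin 4) (b : Fin 4 → K) (hbj : b j = 0)
    (F : MvPolynomial (Fin 4) K) (hF : (q : ℕ∞) ≤ CentreBlowup.ordAlong Finset.univ F) :
    aeval (fun i => if i = j then (X j : MvPolynomial (Fin 4) K) else X j * (X i + C (b i))) F =
      X j ^ q * PointBlowup.translate b (CentreBlowup.chartTransform q Finset.univ j F) := by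
  classical
  have hF' : ∀ d ∈ F.support, q ≤ d.degree := fun d hd => by
    have h := (CentreBlowup.le_ordAlong_iff.mp hF) d hd
    rw [CentreBlowup.degIn_univ] at h
    exact_mod_cast h
  conv_lhs => rw [F.as_sum, map_sum]
  rw [CentreBlowup.chartTransform, PointBlowup.translate, map_sum, Finset.mul_sum]
  refine Finset.sum_congr rfl fun d hd => ?_
  rw [← PointBlowup.translate, aeval_blowup_monomial q j b hbj d (hF' d hd), CentreBlowup.chartExponent,
    CentreBlowup.degIn_univ]

/-! ## 2. `D^{(β)}(y_j^p · T) = y_j^p · D^{(β)} T` for `|β| < p` -/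

/-- `D^{(γ)}(y_j^p) = 0` for `0 < |γ| < p` in characteristic `p` (`C(p, k) ≡ 0`). [folklore] -/
theorem hasseDeriv_X_pow_prime (p : ℕ) [hp : Fact p.Prime] [CharP K p] (j : Fin 4)
    {γ : Fin 4 →₀ ℕ} (hγ0 : γ ≠ 0) (hγp : γ.degree < p) :
    Resolution.hasseDeriv K γ ((X j : MvPolynomial (Fin 4) K) ^ p) = 0 := by
  classical
  by_cases hγ : γ = Finsupp.single j (γ j)
  · rw [hγ, Resolution.hasseDeriv_X_pow]
    have hk0 : γ j ≠ 0 := by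
      intro h; rw [h, Finsupp.single_zero] at hγ; exact hγ0 hγ
    have hkp : γ j < p := lt_of_le_of_lt (Finsupp.le_degree j γ) hγp
    have hcast : ((p.choose (γ j) : ℕ) : MvPolynomial (Fin 4) K) = 0 :=
      (CharP.cast_eq_zero_iff (MvPolynomial (Fin 4) K) p _).mpr (hp.out.dvd_choose_self hk0 hkp)
    rw [hcast, zero_mul]
  · -- some other variable occurs in `γ`: no monomial of `(x_j + u_j)^p` has it
    ext e
    rw [Resolution.coeff_hasseDeriv, coeff_zero, coeff_X_pow]
    have hne : Finsupp.single j p ≠ γ + e := by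
      intro h
      apply hγ
      ext i
      by_cases hij : i = j
      · subst hij; rw [Finsupp.single_eq_same]
      · have := DFunLike.congr_fun h i
        rw [Finsupp.single_apply, if_neg (Ne.symm hij), Finsupp.add_apply] at this
        rw [Finsupp.single_apply, if_neg (Ne.symm hij)]
        omega
    rw [if_neg hne, mul_zero]

/-- **`D^{(β)}(y_j^p · T) = y_j^p · D^{(β)} T`** for `|β| < p` (Leibniz; the terms with a derivative
on `y_j^p` vanish by `hasseDeriv_X_pow_prime`). [folklore] -/
theorem hasseDeriv_X_pow_mul (p : ℕ) [Fact p.Prime] [CharP K p] (j : Fin 4)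
    (T : MvPolynomial (Fin 4) K) {β : Fin 4 →₀ ℕ} (hβp : β.degree < p) :
    Resolution.hasseDeriv K β ((X j : MvPolynomial (Fin 4) K) ^ p * T) =
      X j ^ p * Resolution.hasseDeriv K β T := by
  classical
  rw [Resolution.hasseDeriv_mul, Finset.sum_eq_single (0, β)]
  · rw [Resolution.hasseDeriv_zero_apply]
  · rintro ⟨γ₁, γ₂⟩ hmem hne
    rw [Finset.HasAntidiagonal.mem_antidiagonal] at hmem
    have hγ₁ : γ₁ ≠ 0 := by
      rintro rfl
      apply hne
      simp only [zero_add] at hmem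
      rw [hmem]
    have hdeg : γ₁.degree < p := lt_of_le_of_lt (by
      have := map_add Finsupp.degree γ₁ γ₂; rw [hmem] at this; omega) hβp
    rw [hasseDeriv_X_pow_prime p j hγ₁ hdeg, zero_mul]
  · intro h
    exact (h (Finset.HasAntidiagonal.mem_antidiagonal.mpr (zero_add β))).elim

/-! ## 3. One step down a polynomial arc -/

/-- Evaluation along an arc commutes with the blow-up substitution: `(aeval Λ) ∘ σ_{j,b}^* = aeval Γ`
with `Γ_j = Λ_j`, `Γ_i = Λ_j (Λ_i + b_i)`. [folklore] -/
theorem aeval_comp_blowup (j : Fin 4) (b : Fin 4 → K) (Λ : Fin 4 → Polynomial K)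
    (g : MvPolynomial (Fin 4) K) :
    aeval Λ (aeval (fun i => if i = j then (X j : MvPolynomial (Fin 4) K) else X j * (X i + C (b i))) g) =
      aeval (fun i => if i = j then Λ j else Λ j * (Λ i + Polynomial.C (b i))) g := by
  have key : (aeval Λ).comp
      (aeval (fun i => if i = j then (X j : MvPolynomial (Fin 4) K) else X j * (X i + C (b i)))) =
      aeval (fun i => if i = j then Λ j else Λ j * (Λ i + Polynomial.C (b i))) := by
    refine MvPolynomial.algHom_ext fun i => ?_
    rw [AlgHom.comp_apply, aeval_X, aeval_X]
    split_ifs with h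
    · rw [aeval_X]
    · rw [map_mul, map_add, aeval_X, aeval_X, aeval_C, Polynomial.algebraMap_eq]
  rw [← AlgHom.comp_apply, key]

/-- **One step down.**  Let `s` be a state of order `≥ p`, `(j, b)` a point of the exceptional
divisor (`b_j = 0`), `s⁺ = step p univ j b s` the cleaned successor, and `Λ` a polynomial arc at the
level of `s⁺` with `Λ(0)_j = 0`, `Λ_j ≢ 0`.  If `t^m` divides every `D^{(β)}F⁺(Λ)`, `0 < |β| < p`, then
`t^{m+1}` divides every `D^{(γ)}F(σ_{j,b}∘Λ)`, `0 < |γ| < p`:  by the transfer identity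
(`BlowupHasse.map_hasseDeriv_mul_X_pow_mem_span`) `Λ_j^{|γ|}·D^{(γ)}F(σΛ) ∈ ⟨D^{(β)}(y_j^p T)(Λ)⟩ =
Λ_j^p·⟨D^{(β)}T(Λ)⟩ ⊆ (Λ_j^p t^m)` (cleaning is invisible in order `< p`), and `t ∣ Λ_j`,
`p − |γ| ≥ 1`. [OURS] -/
theorem arc_step (p : ℕ) [Fact p.Prime] [CharP K p] [DecidableEq K] (s : State K)
    (hord : (p : ℕ∞) ≤ CentreBlowup.ordAlong Finset.univ s.F) {j : Fin 4} {b : Fin 4 → K}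
    (hbj : b j = 0) {Λ : Fin 4 → Polynomial K} (hΛ0 : (Λ j).coeff 0 = 0) (hΛj : Λ j ≠ 0) {m : ℕ}
    (hdiv : ∀ β : Fin 4 →₀ ℕ, 0 < β.degree → β.degree < p →
      Polynomial.X ^ m ∣ aeval Λ (Resolution.hasseDeriv K β (CentreBlowup.step p Finset.univ j b s).F))
    {γ : Fin 4 →₀ ℕ} (hγ0 : 0 < γ.degree) (hγp : γ.degree < p) :
    Polynomial.X ^ (m + 1) ∣
      aeval (fun i => if i = j then Λ j else Λ j * (Λ i + Polynomial.C (b i)))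
        (Resolution.hasseDeriv K γ s.F) := by
  classical
  set φ : MvPolynomial (Fin 4) K →ₐ[K] MvPolynomial (Fin 4) K :=
    aeval (fun i => if i = j then (X j : MvPolynomial (Fin 4) K) else X j * (X i + C (b i))) with hφ
  have hφj : φ (X j) = X j := by rw [hφ, aeval_X, if_pos rfl]
  have hφi : ∀ i, i ≠ j → φ (X i) = X j * (X i + C (b i)) := fun i hi => by
    rw [hφ, aeval_X, if_neg hi]
  set T := CentreBlowup.pointTransform p Finset.univ j b s with hT
  have hφF : φ s.F = X j ^ p * T := by
    rw [hφ, aeval_blowup_eq p j b hbj s.F hord, hT, CentreBlowup.pointTransform]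
  -- cleaning is invisible to Hasse derivatives of order `0 < |β| < p`
  have hclean : ∀ β : Fin 4 →₀ ℕ, 0 < β.degree → β.degree < p →
      Resolution.hasseDeriv K β (CentreBlowup.step p Finset.univ j b s).F =
        Resolution.hasseDeriv K β T := by
    intro β h0 hp'
    rw [← Equimultiple.hasseDeriv_eq, ← Equimultiple.hasseDeriv_eq]
    exact IsolatedBand.hasseDeriv_deletePthPowers p T h0 hp'
  have hγne : γ ≠ 0 := by
    rintro rfl
    rw [map_zero] at hγ0
    exact lt_irrefl 0 hγ0
  -- the transfer identity, mapped along the arc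
  have hmem := BlowupHasse.map_hasseDeriv_mul_X_pow_mem_span j b φ hφj hφi s.F hγne
  have hmap := Ideal.mem_map_of_mem (aeval Λ).toRingHom hmem
  rw [Ideal.map_span] at hmap
  have hle : Ideal.span ((aeval Λ).toRingHom '' {g | ∃ β : Fin 4 →₀ ℕ, 0 < β.degree ∧
      β.degree ≤ γ.degree ∧ g = Resolution.hasseDeriv K β (φ s.F)}) ≤
      Ideal.span {Λ j ^ p * Polynomial.X ^ m} := by
    rw [Ideal.span_le]
    rintro _ ⟨g, ⟨β, hβ0, hβle, rfl⟩, rfl⟩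
    have hβp : β.degree < p := lt_of_le_of_lt hβle hγp
    rw [SetLike.mem_coe, Ideal.mem_span_singleton]
    show Λ j ^ p * Polynomial.X ^ m ∣ aeval Λ (Resolution.hasseDeriv K β (φ s.F))
    rw [hφF, hasseDeriv_X_pow_mul p j T hβp, map_mul, map_pow, aeval_X, ← hclean β hβ0 hβp]
    exact mul_dvd_mul_left _ (hdiv β hβ0 hβp)
  have h2 := hle hmap
  rw [Ideal.mem_span_singleton] at h2
  have h2' : Λ j ^ p * Polynomial.X ^ m ∣
      aeval (fun i => if i = j then Λ j else Λ j * (Λ i + Polynomial.C (b i)))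
        (Resolution.hasseDeriv K γ s.F) * Λ j ^ γ.degree := by
    have h := h2
    rw [AlgHom.toRingHom_eq_coe, RingHom.coe_coe, map_mul, map_pow, aeval_X, hφ,
      aeval_comp_blowup] at h
    exact h
  have hsplit : Λ j ^ p = Λ j ^ γ.degree * Λ j ^ (p - γ.degree) := by
    rw [← pow_add, Nat.add_sub_cancel' hγp.le]
  rw [hsplit, mul_assoc, mul_comm (aeval _ _) _] at h2'
  have h3 := (mul_dvd_mul_iff_left (pow_ne_zero _ hΛj)).mp h2'
  have hX : Polynomial.X ∣ Λ j ^ (p - γ.degree) :=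
    dvd_pow (Polynomial.X_dvd_iff.mpr hΛ0) (Nat.sub_ne_zero_of_lt hγp)
  rw [pow_succ']
  exact dvd_trans (mul_dvd_mul hX dvd_rfl) h3

/-- Constant and linear terms of the pushed-down arc `Γ = σ_{j,b}∘Λ`: `Γ(0) = 0` and
`Γ'(0) = Λ_j'(0) · (direction of the point (j, b))`. [folklore] -/
theorem arc_coeff (j : Fin 4) (b : Fin 4 → K) {Λ : Fin 4 → Polynomial K}
    (hΛ0 : ∀ i, (Λ i).coeff 0 = 0) (i : Fin 4) :
    (if i = j then Λ j else Λ j * (Λ i + Polynomial.C (b i))).coeff 0 = 0 ∧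
      (if i = j then Λ j else Λ j * (Λ i + Polynomial.C (b i))).coeff 1 =
        (Λ j).coeff 1 * PointBlowup.direction j b i := by
  classical
  by_cases hij : i = j
  · subst hij
    rw [if_pos rfl, PointBlowup.direction, Function.update_self, mul_one]
    exact ⟨hΛ0 _, rfl⟩
  · rw [if_neg hij, PointBlowup.direction, Function.update_of_ne hij]
    constructor
    · rw [Polynomial.mul_coeff_zero, hΛ0 j, zero_mul]
    · rw [Polynomial.coeff_mul, Finset.Nat.sum_antidiagonal_succ, Finset.Nat.antidiagonal_zero,
        Finset.sum_singleton]
      simp only [zero_add, hΛ0 j, zero_mul, Polynomial.coeff_add, Polynomial.coeff_C_zero, hΛ0 i]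

/-! ## 4. Along a free segment: the arc at the bottom -/

/-- **The arc of a free segment.**  Along a witnessed chain whose steps `ℓ, …, ℓ+n` are followed
by FREE steps (`¬ IsSatellite j b m` for `ℓ ≤ m < ℓ + n`), there is a polynomial arc `Λ` at level `ℓ`
through the origin, with linear term a NON-ZERO multiple of the direction of step `ℓ`, along which
every `D^{(γ)}F_ℓ`, `0 < |γ| < p`, vanishes to order `≥ n + 1` (top arc `t·(1,1,1,1)` at level
`ℓ+n+1`, pushed down by `arc_step`; freeness keeps the linear term of the chart coordinate alive).
[OURS] -/
theorem arc_segment (p : ℕ) [Fact p.Prime] [CharP K p] [DecidableEq K] {c : ℕ → State K}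
    {j : ℕ → Fin 4} {b : ℕ → Fin 4 → K} (hw : FreeTail.IsWitnessedChain p c j b) (n ℓ : ℕ)
    (hfree : ∀ m, ℓ ≤ m → m < ℓ + n → ¬ FreeTail.IsSatellite j b m) :
    ∃ Λ : Fin 4 → Polynomial K, (∀ i, (Λ i).coeff 0 = 0) ∧
      (∃ a : K, a ≠ 0 ∧ ∀ i, (Λ i).coeff 1 = a * PointBlowup.direction (j ℓ) (b ℓ) i) ∧
      ∀ γ : Fin 4 →₀ ℕ, 0 < γ.degree → γ.degree < p →
        Polynomial.X ^ (n + 1) ∣ aeval Λ (Resolution.hasseDeriv K γ (c ℓ).F) := by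
  induction n generalizing ℓ with
  | zero =>
    obtain ⟨hord, hbj, -, -, -⟩ := hw ℓ
    have h0 : ∀ i : Fin 4, ((fun _ : Fin 4 => (Polynomial.X : Polynomial K)) i).coeff 0 = 0 :=
      fun _ => Polynomial.coeff_X_zero
    refine ⟨fun i => if i = j ℓ then Polynomial.X else
      Polynomial.X * (Polynomial.X + Polynomial.C (b ℓ i)),
      fun i => (arc_coeff (j ℓ) (b ℓ) h0 i).1, ⟨1, one_ne_zero, fun i => ?_⟩, fun γ hγ0 hγp => ?_⟩
    · rw [(arc_coeff (j ℓ) (b ℓ) h0 i).2, Polynomial.coeff_X_one]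
    · exact arc_step p (c ℓ) hord hbj (Λ := fun _ => Polynomial.X) Polynomial.coeff_X_zero
        Polynomial.X_ne_zero (m := 0) (fun β _ _ => by rw [pow_zero]; exact one_dvd _) hγ0 hγp
  | succ n ih =>
    obtain ⟨hord, hbj, -, -, hc⟩ := hw ℓ
    obtain ⟨Λ, hΛ0, ⟨a, ha, hΛ1⟩, hdiv⟩ :=
      ih (ℓ + 1) (fun m hm1 hm2 => hfree m (by omega) (by omega))
    have hfreeℓ : ¬ FreeTail.IsSatellite j b ℓ := hfree ℓ le_rfl (by omega)
    -- the linear coefficient of `Λ_{j ℓ}` is non-zero because step `ℓ + 1` is free w.r.t. `{x_{j ℓ} = 0}`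
    have hcoef : (Λ (j ℓ)).coeff 1 ≠ 0 := by
      rw [hΛ1 (j ℓ)]
      refine mul_ne_zero ha ?_
      rw [PointBlowup.direction]
      by_cases hjj : j ℓ = j (ℓ + 1)
      · rw [hjj, Function.update_self]; exact one_ne_zero
      · rw [Function.update_of_ne hjj]
        exact fun hb0 => hfreeℓ ⟨Ne.symm hjj, hb0⟩
    have hΛj : Λ (j ℓ) ≠ 0 := fun h => by
      rw [h, Polynomial.coeff_zero] at hcoef
      exact hcoef rfl
    refine ⟨fun i => if i = j ℓ then Λ (j ℓ) else Λ (j ℓ) * (Λ i + Polynomial.C (b ℓ i)),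
      fun i => (arc_coeff (j ℓ) (b ℓ) hΛ0 i).1,
      ⟨(Λ (j ℓ)).coeff 1, hcoef, fun i => (arc_coeff (j ℓ) (b ℓ) hΛ0 i).2⟩, fun γ hγ0 hγp => ?_⟩
    refine arc_step p (c ℓ) hord hbj (hΛ0 (j ℓ)) hΛj (m := n + 1) (fun β hβ0 hβp => ?_) hγ0 hγp
    rw [← hc]
    exact hdiv β hβ0 hβp

/-! ## 5. The free-tail lemma -/

/-- Along an arc through the origin, the elements of `𝔪₀` become multiples of `t`. [folklore] -/
theorem X_dvd_aeval_of_mem_originIdeal {Λ : Fin 4 → Polynomial K} (hΛ0 : ∀ i, (Λ i).coeff 0 = 0)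
    {g : MvPolynomial (Fin 4) K} (hg : g ∈ originIdeal K) : Polynomial.X ∣ aeval Λ g := by
  rw [Polynomial.X_dvd_iff, Polynomial.coeff_zero_eq_eval_zero]
  rw [originIdeal, RingHom.mem_ker] at hg
  have key : (Polynomial.evalRingHom (0 : K)).comp
      (aeval Λ : MvPolynomial (Fin 4) K →ₐ[K] Polynomial K).toRingHom =
      MvPolynomial.eval (0 : Fin 4 → K) := by
    refine MvPolynomial.ringHom_ext (fun r => ?_) (fun i => ?_)
    · simp
    · simp [← Polynomial.coeff_zero_eq_eval_zero, hΛ0 i]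
  have h := RingHom.congr_fun key g
  simp only [RingHom.comp_apply, Polynomial.coe_evalRingHom, AlgHom.toRingHom_eq_coe,
    RingHom.coe_coe] at h
  rw [h, hg]

/-- **THE FREE-TAIL LEMMA `FT(p, p)`** (CARD I-7-2 (FT), `FreeTail.NoIsolatedFreeTailAt p p`): over
any field of characteristic `p`, a witnessed `Step0 p` chain whose steps are all FREE from index `k₀`
on passes through a NON-isolated state — indeed `c k₀` itself is not isolated.  Proof: if `c k₀`
were isolated, take a certificate `𝔪₀^N ≤ J_p⁺(F_{k₀}) + 𝔪₀^{N+1}`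
(`IsolationConverse.exists_certificate_of_isIsolated`) and the arc `Λ` of the free segment
`k₀ … k₀+N` (`arc_segment`): `x_{j k₀}^N = g + r` evaluates to `t^N·u(t)^N = g(Λ) + r(Λ) ∈ (t^{N+1})`
with `u(0) ≠ 0` — impossible. [OURS] -/
theorem noIsolatedFreeTailAt_self (p : ℕ) [Fact p.Prime] : FreeTail.NoIsolatedFreeTailAt p p := by
  intro K _ _ _ c j b k₀ hw hfree
  classical
  refine ⟨k₀, fun hiso => ?_⟩
  obtain ⟨N, hN⟩ := IsolationConverse.exists_certificate_of_isIsolated hiso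
  obtain ⟨Λ, hΛ0, ⟨a, ha, hΛ1⟩, hdiv⟩ := arc_segment p hw N k₀ (fun m hm _ => hfree m hm)
  have hXmem : (X (j k₀) : MvPolynomial (Fin 4) K) ∈ originIdeal K := by
    rw [originIdeal, RingHom.mem_ker, MvPolynomial.eval_X]
    rfl
  obtain ⟨g, hg, r, hr, hgr⟩ := Submodule.mem_sup.mp (hN (Ideal.pow_mem_pow hXmem N))
  have hdvd_g : Polynomial.X ^ (N + 1) ∣ aeval Λ g := by
    have hle : singLocusIdeal p (c k₀).F ≤
        (Ideal.span {(Polynomial.X : Polynomial K) ^ (N + 1)}).comap (aeval Λ).toRingHom := by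
      rw [singLocusIdeal, Ideal.span_le]
      rintro _ ⟨α, hα0, hαp, rfl⟩
      rw [SetLike.mem_coe, Ideal.mem_comap, Ideal.mem_span_singleton, Equimultiple.hasseDeriv_eq]
      exact hdiv α hα0 hαp
    have h := hle hg
    rw [Ideal.mem_comap, Ideal.mem_span_singleton] at h
    exact h
  have hdvd_r : Polynomial.X ^ (N + 1) ∣ aeval Λ r := by
    have hle : (originIdeal K).map (aeval Λ).toRingHom ≤ Ideal.span {(Polynomial.X : Polynomial K)} := by
      rw [Ideal.map_le_iff_le_comap]
      intro g' hg'
      rw [Ideal.mem_comap, Ideal.mem_span_singleton]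
      exact X_dvd_aeval_of_mem_originIdeal hΛ0 hg'
    have h1 : (aeval Λ).toRingHom r ∈ ((originIdeal K) ^ (N + 1)).map (aeval Λ).toRingHom :=
      Ideal.mem_map_of_mem _ hr
    rw [Ideal.map_pow] at h1
    have h2 := Ideal.pow_right_mono hle (N + 1) h1
    rw [Ideal.span_singleton_pow, Ideal.mem_span_singleton] at h2
    exact h2
  have hdvd : Polynomial.X ^ (N + 1) ∣ Λ (j k₀) ^ N := by
    have h := congrArg (aeval Λ) hgr
    rw [map_add, map_pow, aeval_X] at h
    rw [← h]
    exact dvd_add hdvd_g hdvd_r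
  -- `Λ_{j k₀} = t · u` with `u(0) = a ≠ 0`
  obtain ⟨u, hu⟩ := Polynomial.X_dvd_iff.mpr (hΛ0 (j k₀))
  have hu0 : u.coeff 0 = a := by
    have h1 := hΛ1 (j k₀)
    rw [hu, Polynomial.coeff_X_mul, PointBlowup.direction, Function.update_self, mul_one] at h1
    exact h1
  rw [hu, mul_pow, pow_succ] at hdvd
  have h3 := (mul_dvd_mul_iff_left (pow_ne_zero N Polynomial.X_ne_zero)).mp hdvd
  rw [Polynomial.X_dvd_iff, Polynomial.coeff_zero_eq_eval_zero, Polynomial.eval_pow,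
    ← Polynomial.coeff_zero_eq_eval_zero, hu0] at h3
  exact ha (pow_eq_zero_iff'.mp h3).1

end FreeTailProof

end Summit.ResolutionOfSingularities.ResolutionOfSingularities.Theorems.PIDim4
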